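import Summits.NavierStokesRegularity.NavierStokesRegularity.Theorems.RungBlowupCofinal.PrecessingLerayReduction
import HarnessLib

/-!
# The mean–wave decomposition is Pineau–Vicol's angular-mean decomposition: `J₃ = 𝓡`,
# zonal `↔` axisymmetric, waves have zero angular mean, the finite `n`-fold wave law, and the
# separation of the Type-I tail
# (route `AngularGalerkinLadder`, crux K1 `RungBlowupCofinal`; Negative lane, theorems only)

Negative-lane bookkeeping for `stmt-NavierStokesRegularity-19959` (K1 of route №8), cell ns-blowup,
refuter5 (K5-78), continuing `MeanWaveFoldRange` (K5-74), `SectoralWaveCasimir` (K5-75) and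
`AzimuthalLeibniz` (K5-76) about the registered line `Cruxes/RungBlowupCofinal/Lines/qlwave.lean`
(v2.1; mean–wave rung profiles `U = V + W`, `V` zonal: `J₃V = 0`, `W` an `n`-fold azimuthal wave:
`J₃(J₃W) = −n²W`, companion `W' = n⁻¹J₃W`, joint tail `‖V y + W y‖ ≤ C/(‖y‖+1)`). Nothing here
asserts a Theses declaration; no definition, no named fact. WHAT THIS IS NOT: not Navier–Stokes
evidence — identities and inequalities for smooth vector fields on `ℝ³` under the rotations `R_θ`
about `e₃` (`Literature.Analysis.FluidPDE.rotZ`) and the Pineau–Vicol angular mean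
(`Literature.Analysis.FluidPDE.angularMeanVec`, arXiv:2607.09619 §6.1); no rung dynamics, no
profile is constructed or excluded.

## Content

* **`angGen_two_apply` (the bridge)**: `J₃u(x) = J(u x) − Du(x)[Jx]` with `J = rotGen` — the
  ladder's third generator IS Pineau–Vicol's rotation operator `𝓡` ((6.1)), so the whole of
  `Literature.Analysis.FluidPDE.PineauVicolAngularMean` (angular mean `⟨·⟩_θ`, fluctuation `(·)_a`,
  Lemma 6.1, the angular Poincaré inequality (6.9), the `L²_μ` orthogonality of Lemma 6.2 (iii),
  Lemma 6.4 / Proposition 6.5 for a general source) applies to the line's letters verbatim.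
* **zonal `↔` axisymmetric** (`isAxisymmetric_of_angGen_eq_zero`,
  `angGen_eq_zero_of_isAxisymmetric`):
  for a `C¹` field, `J₃V = 0` iff `V(R_θ y) = R_θ V(y)` for all `θ` (`IsAxisymmetric`, the KNSS
  letter of the Literature) — by integrating `d/dθ R_{−θ}V(R_θ y) = −R_{−θ}(J₃V)(R_θ y)`
  (`hasDerivAt_rotZ_neg_comp_rotZ`).
* **waves have zero angular mean** (`angularMeanVec_eq_zero_of_wave`: `J₃(J₃W) = −νW`, `ν ≠ 0`
  `⇒ ⟨W⟩_θ = 0`, from `⟨𝓡Z⟩_θ = 0`); hence for `U = V + W`: **`⟨U⟩_θ = V` and `(U)_a = W`**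
  (`angularMeanVec_add_of_zonal_of_wave`, `angularFluctVec_add_of_zonal_of_wave`) — the line's
  split is (6.4)–(6.5) of Pineau–Vicol with a pure `n`-mode fluctuation.
* **finite `n`-fold wave law** (`wave_rotZ`): `W(R_θ y) = R_θ (cos(nθ) W(y) − sin(nθ) W'(y))`,
  by uniqueness for the oscillator `g″ = −n²g` along the rotation flow (`eq_zero_of_oscillator`,
  energy method); corollaries: `2π/n`-equivariance (`wave_rotZ_period`), sign flip under `R_{π/n}`
  (`wave_rotZ_half_period`), and **the companion is a rotated copy**,
  `W'(y) = R_{π/2n} W(R_{−π/2n} y)` (`conj_eq_rotZ`).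
* **separation of the Type-I tail** (`typeI_tails`): `‖V y + W y‖ ≤ C/(‖y‖+1)` for all `y` implies
  `‖V y‖ ≤ C/(‖y‖+1)`, `‖W y‖ ≤ 2C/(‖y‖+1)` and `‖W' y‖ ≤ 2C/(‖y‖+1)` (angular averaging,
  `norm_angularMeanVec_le` / `norm_angularFluctVec_le`, and the rotated-copy formula).

Reading for the line: every hypothesis of `IsMeanWaveProfile` on the pair `(V, W)` is now a
statement about ONE field `U = V + W` — a band-limited divergence-free precessing rung profile
whose non-axisymmetric part `(U)_a` is a pure `n`-mode — with `V = ⟨U⟩_θ`, `W = (U)_a` recovered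
by the kernel, each with its own Type-I tail. For provers: the radial BVP behind stubs 3–4 may
assume the three separate tails. For refuters: Pineau–Vicol's large-`|α|` mechanism (Lemma 6.4,
Proposition 6.5, formalised for a general source in `PineauVicolAngularMean` /
`PineauVicolRDSSLargeAlpha`) is addressed to exactly these letters; what it needs beyond them is
the gradient/pressure control (2.1)–(2.2) of the profile, which `IsMeanWaveProfile` does not carry.
[cite: PineauVicol2026, §6.1 (6.1)–(6.6), Lemma 6.1 (arXiv:2607.09619 pp. 17–19)];
[cite: BullardGellman1954].
-/

noncomputable section

namespace Summit.NavierStokesRegularity.AngularGalerkinLadderMeanWaveAngularMean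

open Set Function MeasureTheory Filter Topology
open scoped ContDiff RealInnerProductSpace
open Literature.Analysis.FluidPDE
open Summit.NavierStokesRegularity.FluidComputer
open Summit.NavierStokesRegularity.FluidComputer.AngularLadder
open Summit.NavierStokesRegularity.AngularGalerkinLadderPrecessingReduction

variable {V W : EuclideanSpace ℝ (Fin 3) → EuclideanSpace ℝ (Fin 3)}

/-- `J₃ u = 𝓡 u`: the ladder's third generator is Pineau–Vicol's rotation operator
`𝓡V = JV − (Jy)·∇V`. [folklore] -/
theorem angGen_two_apply (u : EuclideanSpace ℝ (Fin 3) → EuclideanSpace ℝ (Fin 3))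
    (x : EuclideanSpace ℝ (Fin 3)) :
    angGen 2 u x = rotGen (u x) - fderiv ℝ u x (rotGen x) := by
  rw [rotGen_eq_cross_axis, rotGen_eq_cross_axis]; rfl

/-- `J₃ = 𝓡` as functions. [cite: PineauVicol2026, §6.1 (6.1) (p. 18)] -/
theorem angGen_two_eq (u : EuclideanSpace ℝ (Fin 3) → EuclideanSpace ℝ (Fin 3)) :
    angGen 2 u = fun x => rotGen (u x) - fderiv ℝ u x (rotGen x) :=
  funext (angGen_two_apply u)

/-- A `C¹` field annihilated by `J₃` is axisymmetric (rotation-equivariant about `e₃`). -/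
theorem isAxisymmetric_of_angGen_eq_zero (hV : ContDiff ℝ 1 V) (hV0 : ∀ y, angGen 2 V y = 0) :
    IsAxisymmetric V := by
  intro θ y
  -- `g t = R_{−t} V (R_t y)` has derivative `−R_{−t} (𝓡V)(R_t y) = 0`
  have hg : ∀ t, HasDerivAt (fun t => rotZ (-t) (V (rotZ t y))) 0 t := by
    intro t
    have h := hasDerivAt_rotZ_neg_comp_rotZ hV y t
    have h0 : rotGen (V (rotZ t y)) - fderiv ℝ V (rotZ t y) (rotGen (rotZ t y)) = 0 := by
      rw [← angGen_two_apply]; exact hV0 _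
    have hz : rotZ (-t) (0 : EuclideanSpace ℝ (Fin 3)) = 0 := by
      ext i; fin_cases i <;> simp
    rw [h0, hz, neg_zero] at h
    exact h
  have hconst := is_const_of_deriv_eq_zero (f := fun t => rotZ (-t) (V (rotZ t y)))
    (fun t => (hg t).differentiableAt) (fun t => (hg t).deriv) θ 0
  simp only [neg_zero, rotZ_zero] at hconst
  -- `R_{−θ} V(R_θ y) = V y`; apply `R_θ`
  have := congrArg (rotZ θ) hconst
  rwa [← rotZ_add, add_neg_cancel, rotZ_zero] at this

/-- Conversely an axisymmetric `C¹` field is annihilated by `J₃`. -/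
theorem angGen_eq_zero_of_isAxisymmetric (hV : ContDiff ℝ 1 V) (hax : IsAxisymmetric V) (y) :
    angGen 2 V y = 0 := by
  have h := rotOp_angularMeanVec hV y
  rw [hax.angularMeanVec_eq] at h
  rw [angGen_two_apply]; exact h

/-- A zonal `C¹` field is its own angular mean: `J₃V = 0 ⇒ ⟨V⟩_θ = V`. [folklore] -/
theorem angularMeanVec_eq_self_of_angGen_eq_zero (hV : ContDiff ℝ 1 V)
    (hV0 : ∀ y, angGen 2 V y = 0) : angularMeanVec V = V :=
  (isAxisymmetric_of_angGen_eq_zero hV hV0).angularMeanVec_eq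

/-- An azimuthal wave (`J₃(J₃W) = −νW`, `ν ≠ 0`) has zero angular mean. -/
theorem angularMeanVec_eq_zero_of_wave (hW : ContDiff ℝ ∞ W) {ν : ℝ} (hν : ν ≠ 0)
    (hwave : ∀ y, angGen 2 (angGen 2 W) y = -(ν • W y)) : angularMeanVec W = 0 := by
  have hZ : ContDiff ℝ 1 (angGen 2 W) := (contDiff_angGen hW 2).of_le (by simp)
  have hmean0 : angularMeanVec (angGen 2 (angGen 2 W)) = 0 := by
    rw [angGen_two_eq (angGen 2 W)]; exact angularMeanVec_rotOp hZ
  have hWeq : W = fun x => (-ν⁻¹) • angGen 2 (angGen 2 W) x := by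
    funext x; rw [hwave x, smul_neg, neg_smul, neg_neg, smul_smul, inv_mul_cancel₀ hν, one_smul]
  funext y
  rw [hWeq, angularMeanVec_const_smul, hmean0]
  simp

/-- A wave is its own non-axisymmetric part: `(W)_a = W`. [folklore] -/
theorem angularFluctVec_eq_self_of_wave (hW : ContDiff ℝ ∞ W) {ν : ℝ} (hν : ν ≠ 0)
    (hwave : ∀ y, angGen 2 (angGen 2 W) y = -(ν • W y)) : angularFluctVec W = W := by
  funext y
  rw [angularFluctVec_apply, angularMeanVec_eq_zero_of_wave hW hν hwave]
  simp

/-- **The mean–wave decomposition is Pineau–Vicol's**: for `U = V + W` with `V` zonal and `W` a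
wave, `⟨U⟩_θ = V` and `(U)_a = W`. -/
theorem angularMeanVec_add_of_zonal_of_wave (hV : ContDiff ℝ ∞ V) (hW : ContDiff ℝ ∞ W)
    (hV0 : ∀ y, angGen 2 V y = 0) {ν : ℝ} (hν : ν ≠ 0)
    (hwave : ∀ y, angGen 2 (angGen 2 W) y = -(ν • W y)) :
    angularMeanVec (fun x => V x + W x) = V := by
  funext y
  rw [angularMeanVec_add hV.continuous hW.continuous,
    angularMeanVec_eq_self_of_angGen_eq_zero (hV.of_le (by simp)) hV0,
    angularMeanVec_eq_zero_of_wave hW hν hwave]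
  simp

/-- For `U = V + W` with `V` zonal and `W` a wave, `(U)_a = W`. [folklore] -/
theorem angularFluctVec_add_of_zonal_of_wave (hV : ContDiff ℝ ∞ V) (hW : ContDiff ℝ ∞ W)
    (hV0 : ∀ y, angGen 2 V y = 0) {ν : ℝ} (hν : ν ≠ 0)
    (hwave : ∀ y, angGen 2 (angGen 2 W) y = -(ν • W y)) :
    angularFluctVec (fun x => V x + W x) = W := by
  funext y
  rw [angularFluctVec_apply, angularMeanVec_add_of_zonal_of_wave hV hW hV0 hν hwave]
  simp

/-- **Tail separation**: a joint radial bound on `V + W` passes to `V` (same bound) and to `W`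
(twice the bound). -/
theorem norm_le_of_zonal_of_wave (hV : ContDiff ℝ ∞ V) (hW : ContDiff ℝ ∞ W)
    (hV0 : ∀ y, angGen 2 V y = 0) {ν : ℝ} (hν : ν ≠ 0)
    (hwave : ∀ y, angGen 2 (angGen 2 W) y = -(ν • W y)) {b : ℝ → ℝ}
    (hb : ∀ x, ‖V x + W x‖ ≤ b ‖x‖) (y : EuclideanSpace ℝ (Fin 3)) :
    ‖V y‖ ≤ b ‖y‖ ∧ ‖W y‖ ≤ 2 * b ‖y‖ := by
  constructor
  · have h := norm_angularMeanVec_le (V := fun x => V x + W x) hb y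
    rwa [angularMeanVec_add_of_zonal_of_wave hV hW hV0 hν hwave] at h
  · have h := norm_angularFluctVec_le (V := fun x => V x + W x) hb y
    rwa [angularFluctVec_add_of_zonal_of_wave hV hW hV0 hν hwave] at h

/-- The line's Type-I tail `‖V y + W y‖ ≤ C/(‖y‖+1)` separates. -/
theorem typeI_tail_of_zonal_of_wave (hV : ContDiff ℝ ∞ V) (hW : ContDiff ℝ ∞ W)
    (hV0 : ∀ y, angGen 2 V y = 0) {ν : ℝ} (hν : ν ≠ 0)
    (hwave : ∀ y, angGen 2 (angGen 2 W) y = -(ν • W y)) {C : ℝ}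
    (htail : ∀ y, ‖V y + W y‖ ≤ C / (‖y‖ + 1)) (y : EuclideanSpace ℝ (Fin 3)) :
    ‖V y‖ ≤ C / (‖y‖ + 1) ∧ ‖W y‖ ≤ 2 * (C / (‖y‖ + 1)) :=
  norm_le_of_zonal_of_wave hV hW hV0 hν hwave (b := fun r => C / (r + 1)) htail y

/-! ## The finite `n`-fold wave law -/

section WaveLaw

variable {E : Type*} [NormedAddCommGroup E] [InnerProductSpace ℝ E]

/-- Uniqueness for the harmonic oscillator `g'' = −ω² g` in a real inner product space, energy
method: zero data give the zero solution. [folklore] -/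
theorem eq_zero_of_oscillator {g k : ℝ → E} {c : ℝ} (hg : ∀ t, HasDerivAt g (k t) t)
    (hk : ∀ t, HasDerivAt k (-(c ^ 2) • g t) t) (hg0 : g 0 = 0) (hk0 : k 0 = 0) (t : ℝ) :
    g t = 0 := by
  -- the energy `⟪k, k⟫ + ω² ⟪g, g⟫` is constant
  have he : ∀ s, HasDerivAt (fun s => ⟪k s, k s⟫ + c ^ 2 * ⟪g s, g s⟫) 0 s := by
    intro s
    have h1 := (hk s).inner ℝ (hk s)
    have h2 := (hg s).inner ℝ (hg s)
    have h := h1.add (h2.const_mul (c ^ 2))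
    refine h.congr_deriv ?_
    simp only [inner_smul_left, inner_smul_right, real_inner_comm (k s) (g s),
      RCLike.conj_to_real]
    ring
  have hconst := is_const_of_deriv_eq_zero (fun s => (he s).differentiableAt)
    (fun s => (he s).deriv)
  have hks : ∀ s, k s = 0 := by
    intro s
    have h := hconst s 0
    simp only [hg0, hk0, inner_zero_left, mul_zero, add_zero] at h
    have h3 : ⟪k s, k s⟫ = 0 := by
      have := real_inner_self_nonneg (x := k s)
      have := real_inner_self_nonneg (x := g s)
      nlinarith [sq_nonneg c]
    exact inner_self_eq_zero.1 h3
  -- hence `g' = 0` and `g` is constant `= g 0 = 0`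
  have hg' : ∀ s, HasDerivAt g 0 s := fun s => by simpa [hks s] using hg s
  have := is_const_of_deriv_eq_zero (fun s => (hg' s).differentiableAt)
    (fun s => (hg' s).deriv) t 0
  rw [this, hg0]

end WaveLaw

section Finite

variable {W W' : EuclideanSpace ℝ (Fin 3) → EuclideanSpace ℝ (Fin 3)} {n : ℕ}

/-- `R_θ` is linear: scalars. [folklore] -/
private theorem rotZ_smul' (θ c : ℝ) (v : EuclideanSpace ℝ (Fin 3)) :
    rotZ θ (c • v) = c • rotZ θ v := by
  simpa only [rotZL_apply] using (rotZL θ).map_smul c v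

/-- `R_θ` is linear: negation. [folklore] -/
private theorem rotZ_neg' (θ : ℝ) (v : EuclideanSpace ℝ (Fin 3)) : rotZ θ (-v) = -rotZ θ v := by
  simpa only [rotZL_apply] using (rotZL θ).map_neg v

/-- The pulled-back field `t ↦ R_{−t} Z (R_t y)` has derivative `−R_{−t} (J₃Z)(R_t y)`. -/
theorem hasDerivAt_pullback {Z : EuclideanSpace ℝ (Fin 3) → EuclideanSpace ℝ (Fin 3)}
    (hZ : ContDiff ℝ 1 Z) (y : EuclideanSpace ℝ (Fin 3)) (t : ℝ) :
    HasDerivAt (fun t => rotZ (-t) (Z (rotZ t y))) (-(rotZ (-t) (angGen 2 Z (rotZ t y)))) t := by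
  have h := hasDerivAt_rotZ_neg_comp_rotZ hZ y t
  rwa [← angGen_two_apply] at h

/-- **Finite `n`-fold wave law.** A smooth field with `J₃(J₃W) = −n²W` (`n ≠ 0`) and quadrature
companion `W' = n⁻¹J₃W` transforms under the rotation `R_θ` about `e₃` as
`W(R_θ y) = R_θ (cos(nθ) W(y) − sin(nθ) W'(y))`. [folklore] -/
theorem wave_rotZ (hW : ContDiff ℝ ∞ W) (hn : n ≠ 0)
    (hwave : ∀ y, angGen 2 (angGen 2 W) y = -(((n : ℝ) ^ 2) • W y))
    (hW' : W' = fun y => ((n : ℝ)⁻¹) • angGen 2 W y) (θ : ℝ) (y : EuclideanSpace ℝ (Fin 3)) :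
    W (rotZ θ y) = rotZ θ (Real.cos (n * θ) • W y - Real.sin (n * θ) • W' y) := by
  have hn' : (n : ℝ) ≠ 0 := Nat.cast_ne_zero.2 hn
  set N : ℝ := (n : ℝ) with hN
  set a := W y with ha
  set b := W' y with hb
  have hW1 : ContDiff ℝ 1 W := hW.of_le (by simp)
  have hJ1 : ContDiff ℝ 1 (angGen 2 W) := (contDiff_angGen hW 2).of_le (by simp)
  -- g t = R_{−t} W(R_t y), g₁ t = R_{−t} (J₃W)(R_t y)
  set g : ℝ → EuclideanSpace ℝ (Fin 3) := fun t => rotZ (-t) (W (rotZ t y)) with hg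
  set g₁ : ℝ → EuclideanSpace ℝ (Fin 3) := fun t => rotZ (-t) (angGen 2 W (rotZ t y)) with hg₁
  have hdg : ∀ t, HasDerivAt g (-g₁ t) t := fun t => hasDerivAt_pullback hW1 y t
  have hdg₁ : ∀ t, HasDerivAt g₁ ((N ^ 2) • g t) t := by
    intro t
    have h := hasDerivAt_pullback hJ1 y t
    refine h.congr_deriv ?_
    rw [hwave, rotZ_neg', neg_neg, rotZ_smul']
  -- the trigonometric comparison function and its derivatives
  have hc : ∀ t, HasDerivAt (fun t => Real.cos (N * t)) (-Real.sin (N * t) * (N * 1)) t :=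
    fun t => ((hasDerivAt_id' t).const_mul N).cos
  have hs : ∀ t, HasDerivAt (fun t => Real.sin (N * t)) (Real.cos (N * t) * (N * 1)) t :=
    fun t => ((hasDerivAt_id' t).const_mul N).sin
  set φ : ℝ → EuclideanSpace ℝ (Fin 3) := fun t => Real.cos (N * t) • a - Real.sin (N * t) • b
    with hφ
  set φ' : ℝ → EuclideanSpace ℝ (Fin 3) :=
    fun t => (-Real.sin (N * t) * (N * 1)) • a - (Real.cos (N * t) * (N * 1)) • b with hφ'
  have hdφ : ∀ t, HasDerivAt φ (φ' t) t := fun t => ((hc t).smul_const a).sub ((hs t).smul_const b)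
  have hdφ' : ∀ t, HasDerivAt φ'
      ((-(Real.cos (N * t) * (N * 1)) * (N * 1)) • a -
        ((-Real.sin (N * t) * (N * 1)) * (N * 1)) • b)
      t :=
    fun t => (((hs t).neg.mul_const _).smul_const a).sub (((hc t).mul_const _).smul_const b)
  -- h = g − φ solves the oscillator with zero data
  have hzero := eq_zero_of_oscillator (g := fun t => g t - φ t) (k := fun t => -g₁ t - φ' t)
    (c := N) (fun t => (hdg t).sub (hdφ t)) (fun t => by
      have h := ((hdg₁ t).neg).sub (hdφ' t)
      refine h.congr_deriv ?_
      simp only [hφ, smul_smul, neg_smul, sub_eq_add_neg, neg_add, neg_neg, smul_add, smul_neg]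
      ring_nf) (by
      show g 0 - φ 0 = 0
      simp [hg, hφ, ha]) (by
      show -g₁ 0 - φ' 0 = 0
      have e1 : g₁ 0 = angGen 2 W y := by simp [hg₁]
      have e2 : φ' 0 = -(N • b) := by simp [hφ']
      rw [e1, e2, hb, hW']
      simp only [smul_smul, mul_inv_cancel₀ hn', one_smul]
      abel) θ
  -- unwrap
  have hgθ : g θ = φ θ := sub_eq_zero.1 hzero
  simp only [hg, hφ] at hgθ
  have := congrArg (rotZ θ) hgθ
  rwa [← rotZ_add, add_neg_cancel, rotZ_zero] at this

end Finite

section Consequences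

variable {V W W' : EuclideanSpace ℝ (Fin 3) → EuclideanSpace ℝ (Fin 3)} {n : ℕ}

/-- **`n`-fold symmetry**: an `n`-fold wave is equivariant under the rotation by `2π/n`. -/
theorem wave_rotZ_period (hW : ContDiff ℝ ∞ W) (hn : n ≠ 0)
    (hwave : ∀ y, angGen 2 (angGen 2 W) y = -(((n : ℝ) ^ 2) • W y)) (y : EuclideanSpace ℝ (Fin 3)) :
    W (rotZ (2 * Real.pi / n) y) = rotZ (2 * Real.pi / n) (W y) := by
  have hn' : (n : ℝ) ≠ 0 := Nat.cast_ne_zero.2 hn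
  rw [wave_rotZ hW hn hwave rfl]
  have : (n : ℝ) * (2 * Real.pi / n) = 2 * Real.pi := by field_simp
  rw [this, Real.cos_two_pi, Real.sin_two_pi, one_smul, zero_smul, sub_zero]

/-- **Sign flip under the half period**: `W(R_{π/n} y) = −R_{π/n} W(y)`. -/
theorem wave_rotZ_half_period (hW : ContDiff ℝ ∞ W) (hn : n ≠ 0)
    (hwave : ∀ y, angGen 2 (angGen 2 W) y = -(((n : ℝ) ^ 2) • W y)) (y : EuclideanSpace ℝ (Fin 3)) :
    W (rotZ (Real.pi / n) y) = -rotZ (Real.pi / n) (W y) := by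
  have hn' : (n : ℝ) ≠ 0 := Nat.cast_ne_zero.2 hn
  rw [wave_rotZ hW hn hwave rfl]
  have : (n : ℝ) * (Real.pi / n) = Real.pi := by field_simp
  rw [this, Real.cos_pi, Real.sin_pi, zero_smul, sub_zero, neg_one_smul, rotZ_neg']

/-- **The quadrature companion is a rotated copy**: `W'(y) = R_{π/2n} W(R_{−π/2n} y)`. -/
theorem conj_eq_rotZ (hW : ContDiff ℝ ∞ W) (hn : n ≠ 0)
    (hwave : ∀ y, angGen 2 (angGen 2 W) y = -(((n : ℝ) ^ 2) • W y))
    (hW' : W' = fun y => ((n : ℝ)⁻¹) • angGen 2 W y) (y : EuclideanSpace ℝ (Fin 3)) :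
    W' y = rotZ (Real.pi / (2 * n)) (W (rotZ (-(Real.pi / (2 * n))) y)) := by
  have hn' : (n : ℝ) ≠ 0 := Nat.cast_ne_zero.2 hn
  rw [wave_rotZ hW hn hwave hW' (-(Real.pi / (2 * n))) y]
  have : (n : ℝ) * (-(Real.pi / (2 * n))) = -(Real.pi / 2) := by field_simp
  rw [this, Real.cos_neg, Real.sin_neg, Real.cos_pi_div_two, Real.sin_pi_div_two, zero_smul,
    zero_sub, neg_smul, neg_neg, one_smul, ← rotZ_add, add_neg_cancel, rotZ_zero]

/-- Hence the companion obeys the same radial bound as `W`. -/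
theorem norm_conj_le (hW : ContDiff ℝ ∞ W) (hn : n ≠ 0)
    (hwave : ∀ y, angGen 2 (angGen 2 W) y = -(((n : ℝ) ^ 2) • W y))
    (hW' : W' = fun y => ((n : ℝ)⁻¹) • angGen 2 W y) {b : ℝ → ℝ} (hb : ∀ x, ‖W x‖ ≤ b ‖x‖)
    (y : EuclideanSpace ℝ (Fin 3)) : ‖W' y‖ ≤ b ‖y‖ := by
  rw [conj_eq_rotZ hW hn hwave hW' y, norm_rotZ]
  have h := hb (rotZ (-(Real.pi / (2 * n))) y)
  rwa [norm_rotZ] at h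

/-- **All three Type-I tails** of a mean–wave field `U = V + W` with `‖U y‖ ≤ C/(‖y‖+1)`:
`‖V‖ ≤ C/(‖y‖+1)`, `‖W‖ ≤ 2C/(‖y‖+1)`, `‖W'‖ ≤ 2C/(‖y‖+1)`. -/
theorem typeI_tails (hV : ContDiff ℝ ∞ V) (hW : ContDiff ℝ ∞ W)
    (hV0 : ∀ y, angGen 2 V y = 0) (hn : n ≠ 0)
    (hwave : ∀ y, angGen 2 (angGen 2 W) y = -(((n : ℝ) ^ 2) • W y))
    (hW' : W' = fun y => ((n : ℝ)⁻¹) • angGen 2 W y) {C : ℝ}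
    (htail : ∀ y, ‖V y + W y‖ ≤ C / (‖y‖ + 1)) (y : EuclideanSpace ℝ (Fin 3)) :
    ‖V y‖ ≤ C / (‖y‖ + 1) ∧ ‖W y‖ ≤ 2 * (C / (‖y‖ + 1)) ∧ ‖W' y‖ ≤ 2 * (C / (‖y‖ + 1)) := by
  have hν : ((n : ℝ) ^ 2) ≠ 0 := pow_ne_zero 2 (Nat.cast_ne_zero.2 hn)
  have h := fun z => typeI_tail_of_zonal_of_wave hV hW hV0 hν hwave htail z
  exact ⟨(h y).1, (h y).2,
    norm_conj_le hW hn hwave hW' (b := fun r => 2 * (C / (r + 1))) (fun z => (h z).2) y⟩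

end Consequences

end Summit.NavierStokesRegularity.AngularGalerkinLadderMeanWaveAngularMean

end
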